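import Literature.Geometry.Lorentzian.Hypersurface
import Literature.Geometry.Lorentzian.GeodesicSpeed
import Literature.Geometry.Lorentzian.CoordinateFrames
import Literature.Geometry.Lorentzian.CurveThroughVelocity
import HarnessLib

/-!
# The second fundamental form is symmetric (discharge of `secondFundamentalForm_symm`)

This file discharges the named fact
`Literature.Geometry.Lorentzian.PseudoRiemannianMetric.secondFundamentalForm_symm` of
`Literature.Geometry.Lorentzian.Hypersurface` (O'Neill 1983, Ch. 4, Lemma 4: the shape tensor
`II(V, W) = nor D̄_V W` of a semi-Riemannian submanifold is symmetric). In the tree's rendering: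
for a `C²` map `f : N → M` into a manifold with a `C^n` pseudo-Riemannian metric `g` (`n ≥ 1`),
a `C¹` field `ν` along `f` which is normal to `f` (`g(ν, df u) = 0`), and an interior point `y`
of `N`, the bilinear form `K_ν(v, w)` on `T_y N` of `Hypersurface.lean` — the one agreeing with
`g(D_v ν, df w)` for `v` in the canonical basis of `T_y N = E'`, `D_v ν` the covariant derivative
of `t ↦ ν (c_v t)` along `f ∘ c_v` for the chart-straight curve `c_v` with velocity `v`
(`normalDerivAlong`, `covariantDerivAlong` of `Geodesic.lean`) — is symmetric
(`PseudoRiemannianMetric.secondFundamentalForm_symm_holds`).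

## The printed proof and its formalisation

O'Neill, Ch. 4, Lemma 4 (p. 100): "`II(V,W) - II(W,V) = nor(D̄_V W - D̄_W V) = nor [V, W] = 0`",
using Cor. 2 (4) (p. 99, the induced connection on `M̄`-fields along `M` is torsion-free,
`[V, W] = D̄_V W - D̄_W V`) and, implicitly, Lemma 1 (the induced connection is computed in
ambient coordinates, `D̄_V X̄ = ∑ V(fⁱ) ∂ᵢ + ∑ fⁱ D̄_V ∂ᵢ`). The tree's `K_ν` is `⟨D_V ν, W⟩`
rather than `nor D̄_V W`; the two are related by Cor. 2 (5) (compatibility,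
`V⟨X, Y⟩ = ⟨D̄_V X, Y⟩ + ⟨X, D̄_V Y⟩`): `⟨D_V ν, W⟩ = V⟨ν, W⟩ - ⟨ν, D̄_V W⟩ = -⟨ν, D̄_V W⟩`.
Since the tree works with an arbitrary map `f` (not an imbedded submanifold) and with covariant
derivatives along curves, the formal proof runs as follows, everything at the interior point `y`:

* `K_ν` is bilinear and `K_ν(bᵢ, w) = g(D_{bᵢ} ν, df w)` on the canonical basis `bᵢ`
  (`secondFundamentalForm_apply_basis`), so symmetry on pairs of basis vectors suffices
  (`LinearMap.BilinForm.isSymm_iff_basis`).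
* Let `sⱼ` be the coordinate frame of the chart of `N` at `y` (`sⱼ(y) = bⱼ`) and `cᵢ` the
  chart-straight curve with `cᵢ(0) = y`, `cᵢ'(0) = bᵢ` (`velocity_curveThrough_zero_holds` of
  `CurveThroughVelocity.lean`; `cᵢ` is differentiable at `0`).
  The product rule along `f ∘ cᵢ` (`hasDerivAt_val_apply_along` of `GeodesicSpeed.lean`, i.e.
  Cor. 2 (5)) applied to the vanishing function `t ↦ g(ν(cᵢ t), df sⱼ(cᵢ t))` gives
  `K_ν(bᵢ, bⱼ) = -g(ν, D(df sⱼ ∘ cᵢ)/dt (0))` (`val_covariantDerivAlong_add_eq_zero_of_isNormalTo`).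
* `D(df sⱼ ∘ cᵢ)/dt (0)` is symmetric in `i, j` (`covariantDerivAlong_mfderiv_localFrame_comm`):
  in the coordinate frame `∂ₐ` of the chart `φ` of `M` at `f y` (Lemma 1 / O'Neill Ch. 3,
  Prop. 18, the frame formula `covariantDerivAlong_comp_along_eq_sum`) it equals
  `∑ₐ sᵢ(sⱼ(φᵃ ∘ f))(y) ∂ₐ + ∑_{a,b} (df bⱼ)ᵃ (df bᵢ)ᵇ ∇_{∂_b} ∂ₐ`, the coefficients of
  `df sⱼ` being the derivatives `sⱼ(φᵃ ∘ f)` (`localFrame_coeff_mfderiv_eq_mvfderiv`); the first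
  sum is symmetric because coordinate fields commute and the bracket is the commutator on
  functions (`mlieBracket_localFrame_trivializationAt`, `mvfderiv_apply_mlieBracket` — this is
  `df [sᵢ, sⱼ] = 0`, the `nor [V, W] = 0` of the printed proof), the second because the
  Levi-Civita connection is torsion-free (`isLeviCivita_leviCivita_holds`) and the `∂ₐ` commute
  (`∇_{∂_b} ∂ₐ = ∇_{∂ₐ} ∂_b`, Cor. 2 (4)).

Also here (bookkeeping, all proved): the trivialisation of `TM` at `x` read at `x` is the identity
and the chart frame at `x` evaluated at `x` is the basis (`trivializationAt_continuousLinearMapAt_self`,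
`localFrame_trivializationAt_self`), frame coefficients are chart coordinates of `dφ`
(`localFrame_coeff_trivializationAt_eq_coord`), and differentiability of the lifts to `TM` of
fields `z ↦ df_z(W z)` and `t ↦ Y(c t)` (`mdifferentiableAt_lift_mfderiv`,
`mdifferentiableAt_lift_comp_curve`, `mdifferentiableAt_localFrame_coeff_along`).

Not here: linearity of `v ↦ D_v ν` / the formula `K_ν(v, w) = g(D_v ν, df w)` for all `v`
(the named fact `secondFundamentalForm_apply` of `Hypersurface.lean`, discharged in
`SecondFundamentalFormApply.lean`).

## References

* B. O'Neill, *Semi-Riemannian geometry with applications to relativity*, Academic Press 1983,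
  Ch. 4, pp. 98–100: Lemma 1 (the induced connection, computed in coordinates), Cor. 2 (4)–(5)
  (torsion-freeness and compatibility of the induced connection), Lemma 4 (the shape tensor is
  symmetric); Ch. 3, Prop. 18 (covariant derivative along a curve, coordinate formula);
  Ch. 1, Lemma 18 ff. (coordinate vector fields commute). Key `ONeill1983`.
* R. M. Wald, *General Relativity*, Chicago 1984, §10.2, remark below (10.2.13) (`K_{ab}` is
  symmetric). Key `Wald1984`.
-/

noncomputable section

open Bundle Set Filter VectorField
open scoped Manifold ContDiff Topology

namespace Literature.Geometry.Lorentzian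

variable {E : Type*} [NormedAddCommGroup E] [NormedSpace ℝ E] {H : Type*} [TopologicalSpace H]
  {I : ModelWithCorners ℝ E H} {M : Type*} [TopologicalSpace M] [ChartedSpace H M]

/-! ### The chart-straight curve is differentiable at `t = 0` (local helper) -/

section CurveThrough

variable [IsManifold I ∞ M]

/-- Local helper (the tree's `mdifferentiableAt_curveThrough_zero` of
`SecondFundamentalFormApply.lean`, restated privately to keep this file's imports independent of
it): at an interior point `x` the chart-straight curve `t ↦ φ⁻¹(φ x + t v)` is differentiable at
`t = 0` — the affine curve is differentiable and `φ⁻¹` is differentiable at `φ x` because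
`range I` is a neighbourhood of `φ x` (`mdifferentiableWithinAt_extChartAt_symm`,
`range_mem_nhds_isInteriorPoint`). [folklore] -/
private theorem mdifferentiableAt_curveThrough_zero_aux {x : M} (hx : I.IsInteriorPoint x)
    (v : TangentSpace I x) : MDifferentiableAt 𝓘(ℝ, ℝ) I (curveThrough I x v) 0 := by
  have ha : MDifferentiableAt 𝓘(ℝ, ℝ) 𝓘(ℝ, E) (fun t : ℝ ↦ extChartAt I x x + t • (show E from v))
      0 :=
    (hasMFDerivAt_lineThrough (extChartAt I x x) (show E from v) 0).mdifferentiableAt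
  have ha0 : (fun t : ℝ ↦ extChartAt I x x + t • (show E from v)) 0 = extChartAt I x x := by simp
  have hsymm : MDiffAt (extChartAt I x).symm (extChartAt I x x) :=
    (mdifferentiableWithinAt_extChartAt_symm (mem_extChartAt_target x)).mdifferentiableAt
      (range_mem_nhds_isInteriorPoint hx)
  rw [← ha0] at hsymm
  exact hsymm.comp 0 ha

end CurveThrough

/-! ### The trivialisation of `TM` at a point, read at that point -/

section Trivialization

variable [IsManifold I ∞ M]

/-- The trivialisation of `TM` at `x`, read at `x` itself, is the identity (`dφ_x = id` in the
tangent space identification of the preferred chart). [folklore] -/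
theorem trivializationAt_continuousLinearMapAt_self (x : M) (v : TangentSpace I x) :
    (trivializationAt E (TangentSpace I) x).continuousLinearMapAt ℝ x v = v := by
  rw [TangentBundle.continuousLinearMapAt_trivializationAt (mem_chart_source H x),
    mfderiv_extChartAt_self]
  rfl

/-- The coordinate frame of the chart at `x`, evaluated at `x`, is the basis `b`:
`sᵢ(x) = bᵢ`. [folklore] -/
theorem localFrame_trivializationAt_self {ι : Type*} (b : Module.Basis ι ℝ E) (x : M) (i : ι) :
    (trivializationAt E (TangentSpace I) x).localFrame b i x = b i := by
  set e := trivializationAt E (TangentSpace I : M → Type _) x with he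
  have hx : x ∈ e.baseSet := FiberBundle.mem_baseSet_trivializationAt' x
  rw [Trivialization.localFrame_apply_of_mem_baseSet _ b hx]
  have h3 : e.basisAt b hx i = e.symmL ℝ x (b i) := by
    rw [e.symmL_apply hx]
    simp [Trivialization.basisAt]
  rw [h3]
  have h := e.symmL_continuousLinearMapAt (R := ℝ) hx (b i)
  rwa [trivializationAt_continuousLinearMapAt_self] at h

/-- The coefficient of a tangent vector `X ∈ T_z M` in the coordinate frame of the chart at `x₀`
is the corresponding coordinate of `dφ_z X`, `φ` the extended chart at `x₀`. [folklore] -/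
theorem localFrame_coeff_trivializationAt_eq_coord {ι : Type*} (b : Module.Basis ι ℝ E) {x₀ z : M}
    (hz : z ∈ (chartAt H x₀).source) (X : TangentSpace I z) (i : ι) :
    (trivializationAt E (TangentSpace I) x₀).localFrame_coeff I b i z X =
      b.coord i (mfderiv I 𝓘(ℝ, E) (extChartAt I x₀) z X) := by
  have hze : z ∈ (trivializationAt E (TangentSpace I) x₀).baseSet := by simpa using hz
  rw [(trivializationAt E (TangentSpace I) x₀).localFrame_coeff_eq_coeff (I := I) (b := b)
    (s := fun _ ↦ X) hze, ← TangentBundle.continuousLinearMapAt_trivializationAt hz,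
    ← Trivialization.continuousLinearMapAt_apply_of_mem ℝ _ hze]
  rfl

end Trivialization

/-! ### Fields along a map `f : N → M`: coefficients, lifts and the frame formula -/

section AlongMap

variable {E' : Type*} [NormedAddCommGroup E'] [NormedSpace ℝ E'] {H' : Type*} [TopologicalSpace H']
  {I' : ModelWithCorners ℝ E' H'} {N : Type*} [TopologicalSpace N] [ChartedSpace H' N]
  [IsManifold I ∞ M] [FiniteDimensional ℝ E]

/-- **Coefficients of `df(w)` in a chart frame are derivatives of chart coordinates.** For
`f : N → M` differentiable at `z` with `f z` in the chart domain of `x₀`, the coefficient of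
`df_z w` in the coordinate frame of the chart `φ` at `x₀` is `w(φᵃ ∘ f)(z) = d(φᵃ ∘ f)_z(w)`
(chain rule). [folklore] -/
theorem localFrame_coeff_mfderiv_eq_mvfderiv {ι : Type*} (b : Module.Basis ι ℝ E) {x₀ : M}
    {f : N → M} {z : N} (hz : f z ∈ (chartAt H x₀).source) (hf : MDifferentiableAt I' I f z)
    (w : TangentSpace I' z) (i : ι) :
    (trivializationAt E (TangentSpace I) x₀).localFrame_coeff I b i (f z) (mfderiv I' I f z w) =
      mvfderiv I' (fun z ↦ b.coord i (extChartAt I x₀ (f z))) z w := by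
  rw [localFrame_coeff_trivializationAt_eq_coord b hz]
  have h1 : HasMFDerivAt I' 𝓘(ℝ, E) (extChartAt I x₀ ∘ f) z
      ((mfderiv I 𝓘(ℝ, E) (extChartAt I x₀) (f z)).comp (mfderiv I' I f z)) :=
    (mdifferentiableAt_extChartAt hz).hasMFDerivAt.comp z hf.hasMFDerivAt
  have h2 : HasMFDerivAt I' 𝓘(ℝ, ℝ) (fun z ↦ b.coord i (extChartAt I x₀ (f z))) z
      ((LinearMap.toContinuousLinearMap (b.coord i)).comp
        ((mfderiv I 𝓘(ℝ, E) (extChartAt I x₀) (f z)).comp (mfderiv I' I f z))) :=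
    (LinearMap.toContinuousLinearMap (b.coord i)).hasMFDerivAt.comp z h1
  simp only [mvfderiv, h2.mfderiv]
  rfl

/-- The coefficient functions, in an atlas trivialisation `e` of `TM`, of a field `Y` along
`f : N → M` whose lift `z ↦ (f z, Y z)` to `TM` is differentiable at `z₀` (with `f z₀` in the
base set of `e`) are differentiable at `z₀` (read the lift in `e`). [folklore] -/
theorem mdifferentiableAt_localFrame_coeff_along {ι : Type*}
    (e : Trivialization E (TotalSpace.proj : TangentBundle I M → M)) [MemTrivializationAtlas e]
    (b : Module.Basis ι ℝ E) {f : N → M} {Y : Π z : N, TangentSpace I (f z)} {z₀ : N}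
    (hY : MDifferentiableAt I' I.tangent
      (fun z ↦ (TotalSpace.mk' E (f z) (Y z) : TangentBundle I M)) z₀)
    (he : f z₀ ∈ e.baseSet) (i : ι) :
    MDifferentiableAt I' 𝓘(ℝ, ℝ) (fun z ↦ e.localFrame_coeff I b i (f z) (Y z)) z₀ := by
  have hfc : ContinuousAt f z₀ :=
    ((mdifferentiableAt_totalSpace I
      (fun z ↦ (TotalSpace.mk' E (f z) (Y z) : TangentBundle I M))).1 hY).1.continuousAt
  have h1 : MDifferentiableAt I' 𝓘(ℝ, E)
      (fun z ↦ (e (TotalSpace.mk' E (f z) (Y z) : TangentBundle I M)).2) z₀ :=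
    ((e.mdifferentiableAt_totalSpace_iff I
      (fun z ↦ (TotalSpace.mk' E (f z) (Y z) : TangentBundle I M)) (e.mem_source.2 he)).1 hY).2
  have h2 : MDifferentiableAt I' 𝓘(ℝ, ℝ)
      (fun z ↦ b.coord i ((e (TotalSpace.mk' E (f z) (Y z) : TangentBundle I M)).2)) z₀ :=
    (LinearMap.toContinuousLinearMap (b.coord i)).mdifferentiableAt.comp z₀ h1
  refine h2.congr_of_eventuallyEq ?_
  filter_upwards [hfc.preimage_mem_nhds (e.open_baseSet.mem_nhds he)] with z hz
  rw [e.localFrame_coeff_eq_coeff (I := I) (b := b) (s := fun _ ↦ Y z) hz]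
  simp

omit [FiniteDimensional ℝ E] in
/-- The lift to `TM` of the field `t ↦ Y (c t)` along the curve `f ∘ c`, for a field `Y` along
`f` with differentiable lift at `c t₀` and `c` differentiable at `t₀`, is differentiable at `t₀`
(composition). [folklore] -/
theorem mdifferentiableAt_lift_comp_curve {f : N → M} {Y : Π z : N, TangentSpace I (f z)}
    {c : ℝ → N} {t₀ : ℝ} (hc : MDifferentiableAt 𝓘(ℝ, ℝ) I' c t₀)
    (hY : MDifferentiableAt I' I.tangent
      (fun z ↦ (TotalSpace.mk' E (f z) (Y z) : TangentBundle I M)) (c t₀)) :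
    MDifferentiableAt 𝓘(ℝ, ℝ) I.tangent
      (fun t ↦ (TotalSpace.mk' E ((f ∘ c) t) (Y (c t)) : TangentBundle I M)) t₀ :=
  hY.comp t₀ hc

omit [FiniteDimensional ℝ E] in
/-- The lift to `TM` of the field `z ↦ df_z(W z)` along `f`, for `f` of class `C²` and a vector
field `W` on `N` differentiable at `z₀`, is differentiable at `z₀`: it is the tangent map of `f`
(a `C¹` map `TN → TM`) composed with the lift of `W`. [folklore] -/
theorem mdifferentiableAt_lift_mfderiv [IsManifold I' ∞ N] {f : N → M} (hf : ContMDiff I' I 2 f)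
    {W : Π z : N, TangentSpace I' z} {z₀ : N} (hW : MDiffAt (T% W) z₀) :
    MDifferentiableAt I' I.tangent
      (fun z ↦ (TotalSpace.mk' E (f z) (mfderiv I' I f z (W z)) : TangentBundle I M)) z₀ := by
  have h1 : ContMDiff I'.tangent I.tangent 1 (tangentMap I' I f) :=
    hf.contMDiff_tangentMap (by norm_num)
  exact ((h1 _).mdifferentiableAt one_ne_zero).comp z₀ hW

variable (cov : CovariantDerivative I E (TangentSpace I : M → Type _))

/-- **Frame formula for the covariant derivative, along `f ∘ c`, of a field along `f`.** Let
`Y` be a field along `f : N → M` (`Y z ∈ T_{f z} M`) whose lift to `TM` is differentiable at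
`c 0`, `c` a curve in `N` differentiable at `0`, `f` differentiable at `c 0`, and `x₀` a point
whose chart domain contains `f (c 0)`; let `sₐ` be the coordinate frame of the chart at `x₀` and
`Yᵃ(z)` the coefficients of `Y z` in it. Then
`D(Y ∘ c)/dt (0) = ∑ₐ dYᵃ_{c 0}(c' 0) sₐ + ∑ₐ Yᵃ(c 0) ∇_{df (c' 0)} sₐ` (O'Neill 1983, Ch. 3,
Prop. 3.18, coordinate formula of the proof, p. 66, and Ch. 4, Lemma 4.1: the induced connection
on fields along a submanifold, computed in ambient coordinates): frame independence
(`covariantDerivAlongFrame_eq_of_mem_baseSet`) puts `D/dt` in the frame `sₐ`, the coefficient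
functions of `t ↦ Y (c t)` are `Yᵃ ∘ c` (chain rule), and `(f ∘ c)' = df(c')`.
[cite: ONeill1983, Ch. 3, Prop. 3.18 and Ch. 4, Lemma 4.1] -/
theorem covariantDerivAlong_comp_along_eq_sum {ι : Type*} [Fintype ι]
    (e : Trivialization E (TotalSpace.proj : TangentBundle I M → M)) [MemTrivializationAtlas e]
    (b : Module.Basis ι ℝ E)
    {f : N → M} {Y : Π z : N, TangentSpace I (f z)} {c : ℝ → N}
    (hc : MDifferentiableAt 𝓘(ℝ, ℝ) I' c 0) (hf : MDifferentiableAt I' I f (c 0))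
    (hY : MDifferentiableAt I' I.tangent
      (fun z ↦ (TotalSpace.mk' E (f z) (Y z) : TangentBundle I M)) (c 0))
    (hx : f (c 0) ∈ e.baseSet) :
    covariantDerivAlong cov (f ∘ c) (fun t ↦ Y (c t)) 0 =
      ∑ i, (show ℝ from mfderiv I' 𝓘(ℝ, ℝ) (fun z ↦ e.localFrame_coeff I b i (f z) (Y z))
            (c 0) (velocity I' c 0)) • e.localFrame b i ((f ∘ c) 0) +
        ∑ i, e.localFrame_coeff I b i ((f ∘ c) 0) (Y (c 0)) •
          cov (e.localFrame b i) ((f ∘ c) 0) (mfderiv I' I f (c 0) (velocity I' c 0)) := by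
  have hlift := mdifferentiableAt_lift_comp_curve (I := I) hc hY
  rw [covariantDerivAlong_def, ← covariantDerivAlongFrame_eq_of_mem_baseSet cov
    (trivializationAt E (TangentSpace I : M → Type _) ((f ∘ c) 0)) e (Module.finBasis ℝ E) b
    (FiberBundle.mem_baseSet_trivializationAt' ((f ∘ c) 0)) hx hlift]
  -- the coefficient functions and their derivatives at `0`
  have hcoef : ∀ i, MDifferentiableAt I' 𝓘(ℝ, ℝ)
      (fun z ↦ e.localFrame_coeff I b i (f z) (Y z)) (c 0) := fun i ↦
    mdifferentiableAt_localFrame_coeff_along e b hY hx i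
  have hd : ∀ i, deriv (fun t ↦ e.localFrame_coeff I b i (f (c t)) (Y (c t))) 0 =
      mfderiv I' 𝓘(ℝ, ℝ) (fun z ↦ e.localFrame_coeff I b i (f z) (Y z)) (c 0) (velocity I' c 0) :=
    fun i ↦ (hasDerivAt_comp_curve (f := fun z ↦ e.localFrame_coeff I b i (f z) (Y z))
      (hcoef i) hc).deriv
  -- the velocity of `f ∘ c`
  have hvel : velocity I (f ∘ c) 0 = mfderiv I' I f (c 0) (velocity I' c 0) := by
    simp only [velocity, mfderiv_comp 0 hf hc]
    rfl
  simp only [covariantDerivAlongFrame]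
  rw [hvel]
  congr 1
  exact Finset.sum_congr rfl fun i _ ↦ congrArg (· • e.localFrame b i ((f ∘ c) 0)) (hd i)

end AlongMap

/-! ### Normal fields: `g(D_t ν, df W) = -g(ν, D_t (df W))` -/

namespace PseudoRiemannianMetric

variable {E' : Type*} [NormedAddCommGroup E'] [NormedSpace ℝ E'] {H' : Type*} [TopologicalSpace H']
  {I' : ModelWithCorners ℝ E' H'} {N : Type*} [TopologicalSpace N] [ChartedSpace H' N]
  [IsManifold I ∞ M] [FiniteDimensional ℝ E] [CompleteSpace E] {n : ℕ∞ω} [Fact (1 ≤ n)]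
  (g : PseudoRiemannianMetric I n E (TangentSpace I : M → Type _)) [g.HasLeviCivita]

/-- **Differentiating the normality relation** (O'Neill 1983, Ch. 4, Cor. 4.2 (5):
`V⟨X, Y⟩ = ⟨D_V X, Y⟩ + ⟨X, D_V Y⟩` for the induced connection on fields along a submanifold;
here for fields along an arbitrary map `f`). If `ν` is normal to `f` (`g(ν z, df_z u) = 0` for
all `u`), `c` is a curve in `N`, `W` a vector field on `N`, and the lifts to `TM` of
`t ↦ ν (c t)` and `t ↦ df(W (c t))` are differentiable at `0`, then
`g(D(ν ∘ c)/dt, df W) + g(ν, D(df W ∘ c)/dt) = 0` at `t = 0`: the product rule along the curve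
`f ∘ c` (`hasDerivAt_val_apply_along`, compatibility of the Levi-Civita connection) applied to
the identically vanishing function `t ↦ g(ν (c t), df (W (c t)))`.
[cite: ONeill1983, Ch. 4, Cor. 4.2 (5)] -/
theorem val_covariantDerivAlong_add_eq_zero_of_isNormalTo {f : N → M} {ν : NormalField I f}
    (hν : g.IsNormalTo I' f ν) (c : ℝ → N) (W : Π z : N, TangentSpace I' z)
    (hV : MDifferentiableAt 𝓘(ℝ, ℝ) I.tangent
      (fun t ↦ (TotalSpace.mk' E ((f ∘ c) t) (ν (c t)) : TangentBundle I M)) 0)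
    (hW : MDifferentiableAt 𝓘(ℝ, ℝ) I.tangent
      (fun t ↦ (TotalSpace.mk' E ((f ∘ c) t) (mfderiv I' I f (c t) (W (c t))) :
        TangentBundle I M)) 0) :
    g.val (f (c 0)) (covariantDerivAlong g.leviCivita (f ∘ c) (fun t ↦ ν (c t)) 0)
        (mfderiv I' I f (c 0) (W (c 0))) +
      g.val (f (c 0)) (ν (c 0))
        (covariantDerivAlong g.leviCivita (f ∘ c) (fun t ↦ mfderiv I' I f (c t) (W (c t))) 0) =
      0 := by
  have h := g.hasDerivAt_val_apply_along (isLeviCivita_leviCivita_holds (g := g)).2 (γ := f ∘ c)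
    (V := fun t ↦ ν (c t)) (W := fun t ↦ mfderiv I' I f (c t) (W (c t))) (t₀ := 0) hV hW
  have h0 : (fun t ↦ g.val ((f ∘ c) t) (ν (c t)) (mfderiv I' I f (c t) (W (c t)))) =
      fun _ ↦ (0 : ℝ) := by
    funext t
    exact hν (c t) (W (c t))
  rw [h0] at h
  exact h.unique (hasDerivAt_const (0 : ℝ) (0 : ℝ))

/-! ### The symmetric term: `D(df sᵢ ∘ cⱼ)/dt (0)` is symmetric in `i`, `j` -/

/-- **The covariant derivative of `df(∂ᵢ)` along the `j`-th coordinate curve is symmetric in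
`i, j`** — the computation behind O'Neill's `II(V, W) - II(W, V) = nor(D_V W - D_W V) =
nor [V, W] = 0` (O'Neill 1983, Ch. 4, Lemma 4.4 with Cor. 4.2 (4)), carried out for an arbitrary
`C²` map `f : N → M` at an interior point `y`. Let `sᵢ` be the coordinate frame of the chart of
`N` at `y` (basis `b'`), `cⱼ` the chart-straight curve through `y` with velocity `b'ⱼ = sⱼ(y)`,
and `∂ₐ` the coordinate frame of the chart of `M` at `f y`. By the frame formula
(`covariantDerivAlong_comp_along_eq_sum`),
`D(df sᵢ ∘ cⱼ)/dt (0) = ∑ₐ sⱼ(sᵢ(φᵃ ∘ f))(y) ∂ₐ + ∑_{a,b} (df sᵢ)ᵃ (df sⱼ)ᵇ ∇_{∂_b} ∂ₐ`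
(the coefficients of `df sᵢ` in the frame `∂ₐ` are the derivatives `sᵢ(φᵃ ∘ f)` of the chart
coordinates, `localFrame_coeff_mfderiv_eq_mvfderiv`); the first sum is symmetric because the
coordinate fields of `N` commute (`[sⱼ, sᵢ] = 0`, `mlieBracket_localFrame_trivializationAt`, and
the bracket is the commutator on functions, `mvfderiv_apply_mlieBracket`), the second because
the Levi-Civita connection is torsion-free and the coordinate fields of `M` commute
(`∇_{∂_b} ∂ₐ = ∇_{∂ₐ} ∂_b`, `isLeviCivita_leviCivita_holds`).
[cite: ONeill1983, Ch. 4, Lemma 4.4] -/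
theorem covariantDerivAlong_mfderiv_localFrame_comm [IsManifold I' ∞ N] [CompleteSpace E']
    {f : N → M} (hf : ContMDiff I' I 2 f) {y : N} (hy : I'.IsInteriorPoint y)
    {ι : Type*} (b' : Module.Basis ι ℝ E') (i j : ι) :
    covariantDerivAlong g.leviCivita (f ∘ curveThrough I' y (b' j))
        (fun t ↦ mfderiv I' I f (curveThrough I' y (b' j) t)
          ((trivializationAt E' (TangentSpace I') y).localFrame b' i
            (curveThrough I' y (b' j) t))) 0 =
      covariantDerivAlong g.leviCivita (f ∘ curveThrough I' y (b' i))
        (fun t ↦ mfderiv I' I f (curveThrough I' y (b' i) t)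
          ((trivializationAt E' (TangentSpace I') y).localFrame b' j
            (curveThrough I' y (b' i) t))) 0 := by
  -- frames: `sN` on `N` at `y`, `sM` on `M` at `f y`
  set eM := trivializationAt E (TangentSpace I : M → Type _) (f y) with heM_def
  set bM := Module.finBasis ℝ E with hbM_def
  set eN := trivializationAt E' (TangentSpace I') y with heN_def
  have hfye : (f y) ∈ eM.baseSet := FiberBundle.mem_baseSet_trivializationAt' (f y)
  have hyN : y ∈ eN.baseSet := FiberBundle.mem_baseSet_trivializationAt' y
  -- regularity of the frames
  have hI'1 : IsManifold I' (∞ + 1) N := inferInstanceAs (IsManifold I' ∞ N)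
  have hVB' : ContMDiffVectorBundle ∞ E' (TangentSpace I' : N → Type _) I' :=
    TangentBundle.contMDiffVectorBundle
  have hsN2 : ∀ k, CMDiffAt 2 (T% (eN.localFrame b' k)) y := fun k ↦
    (contMDiffAt_localFrame_of_mem ∞ eN b' k hyN).of_le (WithTop.coe_le_coe.mpr le_top)
  have hsN1 : ∀ k, MDiffAt (T% (eN.localFrame b' k)) y := fun k ↦
    (hsN2 k).mdifferentiableAt two_ne_zero
  have hsM : ∀ a, MDiffAt (T% (eM.localFrame bM a)) (f y) := fun a ↦
    (contMDiffAt_localFrame_of_mem 1 eM bM a hfye).mdifferentiableAt one_ne_zero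
  have hsNy : ∀ k, eN.localFrame b' k y = b' k := fun k ↦ localFrame_trivializationAt_self b' y k
  -- `f` is differentiable, and maps a neighbourhood of `y` into the chart domain of `(f y)`
  have hfd : ∀ z, MDifferentiableAt I' I f z := fun z ↦ (hf z).mdifferentiableAt two_ne_zero
  have hfn : ∀ᶠ z in 𝓝 y, f z ∈ (chartAt H (f y)).source :=
    (hf y).continuousAt.preimage_mem_nhds ((chartAt H (f y)).open_source.mem_nhds
      (mem_chart_source H (f y)))
  -- the chart coordinates of `f`, `Fᵃ = φᵃ ∘ f`, are `C²` at `y`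
  have hF2 : ∀ a, CMDiffAt 2 (fun z ↦ bM.coord a (extChartAt I (f y) (f z))) y := fun a ↦
    (LinearMap.toContinuousLinearMap (bM.coord a)).contMDiff.contMDiffAt.comp y
      ((contMDiffAt_extChartAt' (mem_chart_source H (f y))).comp y (hf y))
  -- the coefficients of `df(b'ₖ)` in the frame `sM`
  set Xc : ι → Fin (Module.finrank ℝ E) → ℝ :=
    fun k a ↦ eM.localFrame_coeff I bM a (f y) (mfderiv I' I f y (b' k)) with hXc_def
  -- the common value
  have key : ∀ i j : ι,
      covariantDerivAlong g.leviCivita (f ∘ curveThrough I' y (b' j))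
        (fun t ↦ mfderiv I' I f (curveThrough I' y (b' j) t)
          (eN.localFrame b' i (curveThrough I' y (b' j) t))) 0 =
      ∑ a, mvfderiv I' (fun z ↦ mvfderiv I' (fun z ↦ bM.coord a (extChartAt I (f y) (f z))) z
            (eN.localFrame b' i z)) y (eN.localFrame b' j y) • eM.localFrame bM a (f y) +
        ∑ a, ∑ b, (Xc i a * Xc j b) •
          g.leviCivita (eM.localFrame bM a) (f y) (eM.localFrame bM b (f y)) := by
    intro i j
    have hc0 : curveThrough I' y (b' j) 0 = y := curveThrough_zero I' y (b' j)
    have hc : MDifferentiableAt 𝓘(ℝ, ℝ) I' (curveThrough I' y (b' j)) 0 :=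
      mdifferentiableAt_curveThrough_zero_aux hy (b' j)
    have hvc : velocity I' (curveThrough I' y (b' j)) 0 = b' j :=
      velocity_curveThrough_zero_holds hy (b' j)
    have hfy : f (curveThrough I' y (b' j) 0) ∈ eM.baseSet := by rw [hc0]; exact hfye
    have hY : MDifferentiableAt I' I.tangent (fun z ↦ (TotalSpace.mk' E (f z)
        (mfderiv I' I f z (eN.localFrame b' i z)) : TangentBundle I M))
        (curveThrough I' y (b' j) 0) := by
      rw [hc0]; exact mdifferentiableAt_lift_mfderiv hf (hsN1 i)
    rw [covariantDerivAlong_comp_along_eq_sum g.leviCivita eM bM hc (hfd _) hY hfy]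
    -- transport from `c 0` to `y`
    let Ψ : N → E' → E := fun z u ↦
      ∑ a, (show ℝ from mfderiv I' 𝓘(ℝ, ℝ)
          (fun z ↦ eM.localFrame_coeff I bM a (f z) (mfderiv I' I f z (eN.localFrame b' i z)))
          z u) • eM.localFrame bM a (f z) +
        ∑ a, eM.localFrame_coeff I bM a (f z) (mfderiv I' I f z (eN.localFrame b' i z)) •
          g.leviCivita (eM.localFrame bM a) (f z) (mfderiv I' I f z u)
    have step1 : Ψ (curveThrough I' y (b' j) 0) (velocity I' (curveThrough I' y (b' j)) 0) =
        Ψ y (b' j) := by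
      rw [hvc, hc0]
    refine step1.trans ?_
    -- the two sums at `y`
    have h1 : ∀ a, (show ℝ from mfderiv I' 𝓘(ℝ, ℝ)
        (fun z ↦ eM.localFrame_coeff I bM a (f z) (mfderiv I' I f z (eN.localFrame b' i z)))
          y (b' j)) =
        mvfderiv I' (fun z ↦ mvfderiv I' (fun z ↦ bM.coord a (extChartAt I (f y) (f z))) z
          (eN.localFrame b' i z)) y (eN.localFrame b' j y) := by
      intro a
      have hev : (fun z ↦ eM.localFrame_coeff I bM a (f z)
          (mfderiv I' I f z (eN.localFrame b' i z))) =ᶠ[𝓝 y]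
          fun z ↦ mvfderiv I' (fun z ↦ bM.coord a (extChartAt I (f y) (f z))) z
            (eN.localFrame b' i z) := by
        filter_upwards [hfn] with z hz
        exact localFrame_coeff_mfderiv_eq_mvfderiv bM hz (hfd z) _ a
      rw [hev.mfderiv_eq, hsNy j]
      rfl
    have h2 : ∀ a, eM.localFrame_coeff I bM a (f y) (mfderiv I' I f y (eN.localFrame b' i y)) •
        g.leviCivita (eM.localFrame bM a) (f y) (mfderiv I' I f y (b' j)) =
        ∑ b, (Xc i a * Xc j b) • g.leviCivita (eM.localFrame bM a) (f y) (eM.localFrame bM b (f y)) := by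
      intro a
      have hexp : mfderiv I' I f y (b' j) = ∑ b, Xc j b • eM.localFrame bM b (f y) :=
        eM.eq_sum_localFrame_coeff_smul (I := I) (b := bM)
          (s := fun _ ↦ mfderiv I' I f y (b' j)) hfye
      rw [hexp, map_sum, Finset.smul_sum, hsNy i]
      refine Finset.sum_congr rfl fun b _ ↦ ?_
      rw [map_smul, smul_smul]
    show ∑ a, (show ℝ from mfderiv I' 𝓘(ℝ, ℝ)
          (fun z ↦ eM.localFrame_coeff I bM a (f z) (mfderiv I' I f z (eN.localFrame b' i z)))
          y (b' j)) • eM.localFrame bM a (f y) +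
        ∑ a, eM.localFrame_coeff I bM a (f y) (mfderiv I' I f y (eN.localFrame b' i y)) •
          g.leviCivita (eM.localFrame bM a) (f y) (mfderiv I' I f y (b' j)) = _
    simp only [h1, h2]
  -- symmetry of the common value
  rw [key i j, key j i]
  -- (a) the coordinate fields of `N` commute
  have hbr : ∀ a, mvfderiv I' (fun z ↦ mvfderiv I' (fun z ↦ bM.coord a (extChartAt I (f y) (f z))) z
        (eN.localFrame b' i z)) y (eN.localFrame b' j y) =
      mvfderiv I' (fun z ↦ mvfderiv I' (fun z ↦ bM.coord a (extChartAt I (f y) (f z))) z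
        (eN.localFrame b' j z)) y (eN.localFrame b' i y) := by
    intro a
    have h := mvfderiv_apply_mlieBracket (hF2 a) (hsN2 j) (hsN2 i)
    have hb0 : mlieBracket I' (eN.localFrame b' j) (eN.localFrame b' i) y = 0 :=
      mlieBracket_localFrame_trivializationAt b' (mem_chart_source H' y) j i
    rw [hb0, map_zero] at h
    exact sub_eq_zero.1 h.symm
  -- (b) torsion-freeness: `∇_{∂_b} ∂ₐ = ∇_{∂ₐ} ∂_b`
  have hT0 : g.leviCivita.torsion = 0 := (isLeviCivita_leviCivita_holds (g := g)).1
  have hC : ∀ a b, g.leviCivita (eM.localFrame bM a) (f y) (eM.localFrame bM b (f y)) =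
      g.leviCivita (eM.localFrame bM b) (f y) (eM.localFrame bM a (f y)) := by
    intro a b
    have h := (CovariantDerivative.torsion_eq_zero_iff g.leviCivita).1 hT0 (hsM b) (hsM a)
    have hb0 : mlieBracket I (eM.localFrame bM b) (eM.localFrame bM a) (f y) = 0 :=
      mlieBracket_localFrame_trivializationAt bM (mem_chart_source H (f y)) b a
    rw [hb0] at h
    exact sub_eq_zero.1 h
  congr 1
  · exact Finset.sum_congr rfl fun a _ ↦ by rw [hbr a]
  · rw [Finset.sum_comm]
    refine Finset.sum_congr rfl fun a _ ↦ Finset.sum_congr rfl fun b _ ↦ ?_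
    rw [hC b a, mul_comm]

/-! ### Symmetry of the second fundamental form -/

variable [FiniteDimensional ℝ E']

omit [CompleteSpace E] [Fact (1 ≤ n)] in
/-- **Discharge of `secondFundamentalForm_symm`: the second fundamental form is symmetric**
(O'Neill 1983, Ch. 4, Lemma 4 (p. 100 of the book): "the function `II(V, W) = nor D_V W` is
`𝔉(M)`-bilinear and symmetric", printed proof `II(V,W) - II(W,V) = nor(D_V W - D_W V) =
nor [V, W] = 0`, resting on Cor. 4.2 (4) (torsion-freeness of the induced connection) and, for
the passage from `nor D_V W` to `g(D_V ν, W) = -g(ν, D_V W)`, on Cor. 4.2 (5) (compatibility);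
Wald 1984, §10.2, below (10.2.13)). For `f : N → M` of class `C²`, a `C¹` field `ν` along `f`
normal to `f`, and an interior point `y`, the bilinear form `K_ν` of `Hypersurface.lean` is
symmetric on `T_y N`. Proof: `K_ν` is bilinear and agrees with `g(D_{bᵢ} ν, df w)` on the
canonical basis `bᵢ` (`secondFundamentalForm_apply_basis`), so it suffices to show
`g(D_{bᵢ} ν, df bⱼ) = g(D_{bⱼ} ν, df bᵢ)` (`LinearMap.BilinForm.isSymm_iff_basis`). With `sⱼ` the
coordinate frame of the chart at `y` (`sⱼ(y) = bⱼ`) and `cᵢ` the chart-straight curve with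
velocity `bᵢ`, differentiating `g(ν, df sⱼ) = 0` along `cᵢ` gives
`g(D_{bᵢ} ν, df bⱼ) = -g(ν, D(df sⱼ ∘ cᵢ)/dt (0))`
(`val_covariantDerivAlong_add_eq_zero_of_isNormalTo`), and the right-hand side is symmetric in
`i, j` (`covariantDerivAlong_mfderiv_localFrame_comm`: commuting coordinate frames and
torsion-freeness of the Levi-Civita connection). [cite: ONeill1983, Ch. 4, Lemma 4.4] -/
theorem secondFundamentalForm_symm_holds : g.secondFundamentalForm_symm (N := N) I' := by
  intro _ _ _ f ν hf hν hνs y hy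
  haveI : CompleteSpace E' := FiniteDimensional.complete ℝ E'
  -- the canonical basis of `T_y N = E'` and the coordinate frame of the chart at `y`
  set bN : Module.Basis (Fin (Module.finrank ℝ E')) ℝ E' := Module.finBasis ℝ E' with hbN_def
  set eN := trivializationAt E' (TangentSpace I') y with heN_def
  have hyN : y ∈ eN.baseSet := FiberBundle.mem_baseSet_trivializationAt' y
  have hI'1 : IsManifold I' (∞ + 1) N := inferInstanceAs (IsManifold I' ∞ N)
  have hVB' : ContMDiffVectorBundle ∞ E' (TangentSpace I' : N → Type _) I' :=
    TangentBundle.contMDiffVectorBundle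
  have hsN1 : ∀ k, MDiffAt (T% (eN.localFrame bN k)) y := fun k ↦
    (contMDiffAt_localFrame_of_mem ∞ eN bN k hyN).mdifferentiableAt (by simp)
  have hsNy : ∀ k, eN.localFrame bN k y = bN k := fun k ↦ localFrame_trivializationAt_self bN y k
  -- `K(bᵢ, w) = g(D_{bᵢ} ν, df w)` on the canonical basis
  have happ : ∀ (i : Fin (Module.finrank ℝ E')) (w : TangentSpace I' y),
      g.secondFundamentalForm I' f ν y (bN i) w =
        g.val (f y) (g.normalDerivAlong (I' := I') f ν y (bN i)) (mfderiv I' I f y w) :=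
    fun i w ↦ g.secondFundamentalForm_apply_basis f ν y i w
  -- differentiating the normality relation along the coordinate curves
  have hkey : ∀ i j : Fin (Module.finrank ℝ E'),
      g.val (f y) (g.normalDerivAlong (I' := I') f ν y (bN i)) (mfderiv I' I f y (bN j)) =
        -g.val (f y) (ν y) (covariantDerivAlong g.leviCivita (f ∘ curveThrough I' y (bN i))
          (fun t ↦ mfderiv I' I f (curveThrough I' y (bN i) t)
            (eN.localFrame bN j (curveThrough I' y (bN i) t))) 0) := by
    intro i j
    have hc0 : curveThrough I' y (bN i) 0 = y := curveThrough_zero I' y (bN i)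
    have hc : MDifferentiableAt 𝓘(ℝ, ℝ) I' (curveThrough I' y (bN i)) 0 :=
      mdifferentiableAt_curveThrough_zero_aux hy (bN i)
    have hV := mdifferentiableAt_lift_comp_curve (I := I) (Y := ν) hc
      ((hνs _).mdifferentiableAt one_ne_zero)
    have hW : MDifferentiableAt I' I.tangent (fun z ↦ (TotalSpace.mk' E (f z)
        (mfderiv I' I f z (eN.localFrame bN j z)) : TangentBundle I M))
        (curveThrough I' y (bN i) 0) := by
      rw [hc0]; exact mdifferentiableAt_lift_mfderiv hf (hsN1 j)
    have h := g.val_covariantDerivAlong_add_eq_zero_of_isNormalTo hν (curveThrough I' y (bN i))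
      (eN.localFrame bN j) hV (mdifferentiableAt_lift_comp_curve (I := I) hc hW)
    -- transport from `c 0` to `y`
    let Θ : N → ℝ := fun z ↦
      g.val (f z) (covariantDerivAlong g.leviCivita (f ∘ curveThrough I' y (bN i))
          (fun t ↦ ν (curveThrough I' y (bN i) t)) 0) (mfderiv I' I f z (eN.localFrame bN j z)) +
        g.val (f z) (ν z) (covariantDerivAlong g.leviCivita (f ∘ curveThrough I' y (bN i))
          (fun t ↦ mfderiv I' I f (curveThrough I' y (bN i) t)
            (eN.localFrame bN j (curveThrough I' y (bN i) t))) 0)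
    have hΘ : Θ y = 0 := by rw [← hc0]; exact h
    rw [← hsNy j]
    exact eq_neg_of_add_eq_zero_left hΘ
  -- symmetry on the basis, hence symmetry
  refine (LinearMap.BilinForm.isSymm_iff_basis bN).2 fun i j ↦ ?_
  show g.secondFundamentalForm I' f ν y (bN i) (bN j) = g.secondFundamentalForm I' f ν y (bN j) (bN i)
  rw [happ, happ, hkey i j, hkey j i, g.covariantDerivAlong_mfderiv_localFrame_comm hf hy bN j i]

end PseudoRiemannianMetric

end Literature.Geometry.Lorentzian

end
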